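import Summits.CriticalPhenomena.PercolationContinuityZ3.Theorems.PercNearOneGluingNoHeavyLowerTailMajorityGluingQCertPopcT
import HarnessLib

/-!
# Fast cubic orbit keys II: the blocks of `classList3` and the canonical coordinates in closed form (lane prim-rate, constants-miner 1, gen 37)

Support file for the closed crux `NoHeavyLowerTail` (stmt-CriticalPhenomena-4575), majority-gluing line.  `classList3 m a b c` is the concatenation of
the eight membership blocks (`a∩b∩c`, `a∩b∖c`, `a∖b∩c`, …); read through `tb a` / `tb b` / `tb c` it is a pattern of constant blocks
(`classList3_map_a/b/c`), so the three canonical coordinates `pull m (unrank3 m a b c) a/b/c` are explicit sums of powers of two in the block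
lengths (`pull_unrank3_a/b/c`), and the block lengths are differences of the seven popcounts `|a|, |b|, |c|, |a∧b|, |a∧c|, |b∧c|, |a∧b∧c|`
(**`block_lengths`**).  Pure list arithmetic; no sorries.
-/

namespace Summit.CriticalPhenomena.PercolationContinuityZ3.Theorems

namespace HubOnly
namespace QCert

/-! ### The blocks of `classList3` read through a membership test -/

/-- A list all of whose members pass (resp. fail) a test maps to a constant block. -/
theorem map_eq_replicate_of_forall {l : List ℕ} {f : ℕ → Bool} {v : Bool} (h : ∀ x ∈ l, f x = v) :
    l.map f = List.replicate l.length v :=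
  List.map_eq_replicate_iff.mpr h

section Blocks

variable (m a b c : ℕ)

/-- The relays (as a list). -/
def rl : List ℕ := List.range m
/-- Relays in `a`. -/
def la : List ℕ := (rl m).filter fun x => tb a x
/-- Relays not in `a`. -/
def lna : List ℕ := (rl m).filter fun x => !(tb a x)
/-- Relays in `a ∩ b`. -/
def lab : List ℕ := (la m a).filter fun x => tb b x
/-- Relays in `a ∖ b`. -/
def lanb : List ℕ := (la m a).filter fun x => !(tb b x)
/-- Relays in `b ∖ a`. -/
def lnab : List ℕ := (lna m a).filter fun x => tb b x
/-- Relays in neither `a` nor `b`. -/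
def lnanb : List ℕ := (lna m a).filter fun x => !(tb b x)

/-- `classList3` as its eight blocks. -/
theorem classList3_eq : classList3 m a b c =
    (lab m a b).filter (fun x => tb c x) ++ ((lab m a b).filter (fun x => !(tb c x)) ++ ((lanb m a b).filter (fun x => tb c x) ++
      ((lanb m a b).filter (fun x => !(tb c x)) ++ ((lnab m a b).filter (fun x => tb c x) ++ ((lnab m a b).filter (fun x => !(tb c x)) ++
        ((lnanb m a b).filter (fun x => tb c x) ++ (lnanb m a b).filter (fun x => !(tb c x)))))))) := rfl

/-- Length bookkeeping: a filter splits a list. -/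
theorem length_filter_split (l : List ℕ) (q : ℕ → Bool) :
    l.length = (l.filter fun x => q x).length + (l.filter fun x => !(q x)).length :=
  List.length_eq_length_filter_add _

/-- Reading `classList3` through `tb a`: a block of `|a|` ones, then zeros. -/
theorem classList3_map_a : (classList3 m a b c).map (fun x => tb a x) =
    List.replicate (la m a).length true ++ List.replicate (lna m a).length false := by
  have hA : ∀ x ∈ la m a, tb a x = true := fun x hx => (List.mem_filter.mp hx).2
  have hN : ∀ x ∈ lna m a, tb a x = false := fun x hx => by simpa using (List.mem_filter.mp hx).2
  have h1 : ∀ x ∈ (lab m a b).filter (fun x => tb c x), tb a x = true := fun x hx =>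
    hA x (List.mem_filter.mp (List.mem_filter.mp hx).1).1
  have h2 : ∀ x ∈ (lab m a b).filter (fun x => !(tb c x)), tb a x = true := fun x hx =>
    hA x (List.mem_filter.mp (List.mem_filter.mp hx).1).1
  have h3 : ∀ x ∈ (lanb m a b).filter (fun x => tb c x), tb a x = true := fun x hx =>
    hA x (List.mem_filter.mp (List.mem_filter.mp hx).1).1
  have h4 : ∀ x ∈ (lanb m a b).filter (fun x => !(tb c x)), tb a x = true := fun x hx =>
    hA x (List.mem_filter.mp (List.mem_filter.mp hx).1).1
  have h5 : ∀ x ∈ (lnab m a b).filter (fun x => tb c x), tb a x = false := fun x hx =>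
    hN x (List.mem_filter.mp (List.mem_filter.mp hx).1).1
  have h6 : ∀ x ∈ (lnab m a b).filter (fun x => !(tb c x)), tb a x = false := fun x hx =>
    hN x (List.mem_filter.mp (List.mem_filter.mp hx).1).1
  have h7 : ∀ x ∈ (lnanb m a b).filter (fun x => tb c x), tb a x = false := fun x hx =>
    hN x (List.mem_filter.mp (List.mem_filter.mp hx).1).1
  have h8 : ∀ x ∈ (lnanb m a b).filter (fun x => !(tb c x)), tb a x = false := fun x hx =>
    hN x (List.mem_filter.mp (List.mem_filter.mp hx).1).1
  rw [classList3_eq]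
  simp only [List.map_append, map_eq_replicate_of_forall h1, map_eq_replicate_of_forall h2, map_eq_replicate_of_forall h3,
    map_eq_replicate_of_forall h4, map_eq_replicate_of_forall h5, map_eq_replicate_of_forall h6, map_eq_replicate_of_forall h7,
    map_eq_replicate_of_forall h8]
  have eA : (la m a).length = ((lab m a b).filter (fun x => tb c x)).length + ((lab m a b).filter (fun x => !(tb c x))).length +
      (((lanb m a b).filter (fun x => tb c x)).length + ((lanb m a b).filter (fun x => !(tb c x))).length) := by
    rw [← length_filter_split, ← length_filter_split]; exact length_filter_split _ _
  have eN : (lna m a).length = ((lnab m a b).filter (fun x => tb c x)).length + ((lnab m a b).filter (fun x => !(tb c x))).length +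
      (((lnanb m a b).filter (fun x => tb c x)).length + ((lnanb m a b).filter (fun x => !(tb c x))).length) := by
    rw [← length_filter_split, ← length_filter_split]; exact length_filter_split _ _
  rw [eA, eN]
  simp only [List.replicate_add, List.append_assoc]

/-- Reading `classList3` through `tb b`: ones on `a ∩ b`, zeros on `a ∖ b`, ones on `b ∖ a`, zeros on the rest. -/
theorem classList3_map_b : (classList3 m a b c).map (fun x => tb b x) =
    List.replicate (lab m a b).length true ++ (List.replicate (lanb m a b).length false ++
      (List.replicate (lnab m a b).length true ++ List.replicate (lnanb m a b).length false)) := by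
  have hP : ∀ (l : List ℕ), ∀ x ∈ l.filter (fun x => tb b x), tb b x = true := fun l x hx => (List.mem_filter.mp hx).2
  have hQ : ∀ (l : List ℕ), ∀ x ∈ l.filter (fun x => !(tb b x)), tb b x = false := fun l x hx => by simpa using (List.mem_filter.mp hx).2
  have h1 : ∀ x ∈ (lab m a b).filter (fun x => tb c x), tb b x = true := fun x hx => hP _ x (List.mem_filter.mp hx).1
  have h2 : ∀ x ∈ (lab m a b).filter (fun x => !(tb c x)), tb b x = true := fun x hx => hP _ x (List.mem_filter.mp hx).1
  have h3 : ∀ x ∈ (lanb m a b).filter (fun x => tb c x), tb b x = false := fun x hx => hQ _ x (List.mem_filter.mp hx).1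
  have h4 : ∀ x ∈ (lanb m a b).filter (fun x => !(tb c x)), tb b x = false := fun x hx => hQ _ x (List.mem_filter.mp hx).1
  have h5 : ∀ x ∈ (lnab m a b).filter (fun x => tb c x), tb b x = true := fun x hx => hP _ x (List.mem_filter.mp hx).1
  have h6 : ∀ x ∈ (lnab m a b).filter (fun x => !(tb c x)), tb b x = true := fun x hx => hP _ x (List.mem_filter.mp hx).1
  have h7 : ∀ x ∈ (lnanb m a b).filter (fun x => tb c x), tb b x = false := fun x hx => hQ _ x (List.mem_filter.mp hx).1
  have h8 : ∀ x ∈ (lnanb m a b).filter (fun x => !(tb c x)), tb b x = false := fun x hx => hQ _ x (List.mem_filter.mp hx).1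
  rw [classList3_eq]
  simp only [List.map_append, map_eq_replicate_of_forall h1, map_eq_replicate_of_forall h2, map_eq_replicate_of_forall h3,
    map_eq_replicate_of_forall h4, map_eq_replicate_of_forall h5, map_eq_replicate_of_forall h6, map_eq_replicate_of_forall h7,
    map_eq_replicate_of_forall h8]
  rw [length_filter_split (lab m a b) (fun x => tb c x), length_filter_split (lanb m a b) (fun x => tb c x),
    length_filter_split (lnab m a b) (fun x => tb c x), length_filter_split (lnanb m a b) (fun x => tb c x)]
  simp only [List.replicate_add, List.append_assoc]

/-- Reading `classList3` through `tb c`: alternating blocks. -/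
theorem classList3_map_c : (classList3 m a b c).map (fun x => tb c x) =
    List.replicate ((lab m a b).filter (fun x => tb c x)).length true ++ (List.replicate ((lab m a b).filter (fun x => !(tb c x))).length false ++
      (List.replicate ((lanb m a b).filter (fun x => tb c x)).length true ++ (List.replicate ((lanb m a b).filter (fun x => !(tb c x))).length false ++
        (List.replicate ((lnab m a b).filter (fun x => tb c x)).length true ++ (List.replicate ((lnab m a b).filter (fun x => !(tb c x))).length false ++
          (List.replicate ((lnanb m a b).filter (fun x => tb c x)).length true ++
            List.replicate ((lnanb m a b).filter (fun x => !(tb c x))).length false)))))) := by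
  have hP : ∀ (l : List ℕ), ∀ x ∈ l.filter (fun x => tb c x), tb c x = true := fun l x hx => (List.mem_filter.mp hx).2
  have hQ : ∀ (l : List ℕ), ∀ x ∈ l.filter (fun x => !(tb c x)), tb c x = false := fun l x hx => by simpa using (List.mem_filter.mp hx).2
  rw [classList3_eq]
  simp only [List.map_append, map_eq_replicate_of_forall (hP (lab m a b)), map_eq_replicate_of_forall (hQ (lab m a b)),
    map_eq_replicate_of_forall (hP (lanb m a b)), map_eq_replicate_of_forall (hQ (lanb m a b)),
    map_eq_replicate_of_forall (hP (lnab m a b)), map_eq_replicate_of_forall (hQ (lnab m a b)),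
    map_eq_replicate_of_forall (hP (lnanb m a b)), map_eq_replicate_of_forall (hQ (lnanb m a b))]

/-- `ofBits` after a block of ones. -/
theorem ofBits_true_append (n : ℕ) (Y : List Bool) : ofBits (List.replicate n true ++ Y) = (2 ^ n - 1) + 2 ^ n * ofBits Y := by
  rw [ofBits_append, ofBits_replicate_true, List.length_replicate]

/-- `ofBits` after a block of zeros. -/
theorem ofBits_false_append (n : ℕ) (Y : List Bool) : ofBits (List.replicate n false ++ Y) = 2 ^ n * ofBits Y := by
  rw [ofBits_append, ofBits_replicate_false, List.length_replicate, Nat.zero_add]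

/-- `classList3` has length `m`. -/
theorem classList3_length' : (classList3 m a b c).length = m := classList3_length m a b c

/-- **The three canonical coordinates in closed form** (block lengths). For `K ∈ {a, b, c}` below `2^m`:
`pull` along the canonical relabelling is `ofBits` of the corresponding block pattern. -/
theorem pull_unrank3_a (ha : a < 2 ^ m) : pull m (unrank3 m a b c) a = 2 ^ (la m a).length - 1 := by
  rw [show unrank3 m a b c = fun p => (classList3 m a b c).getD p p from rfl,
    pull_getD_eq_ofBits m _ (classList3_length m a b c) ha, classList3_map_a, ofBits_true_append, ofBits_replicate_false]
  simp

/-- The canonical second coordinate: ones on `a ∩ b` and on `b ∖ a` (block lengths). -/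
theorem pull_unrank3_b (hb : b < 2 ^ m) : pull m (unrank3 m a b c) b =
    (2 ^ (lab m a b).length - 1) + 2 ^ (lab m a b).length * (2 ^ (lanb m a b).length * (2 ^ (lnab m a b).length - 1)) := by
  rw [show unrank3 m a b c = fun p => (classList3 m a b c).getD p p from rfl,
    pull_getD_eq_ofBits m _ (classList3_length m a b c) hb, classList3_map_b, ofBits_true_append, ofBits_false_append,
    ofBits_true_append, ofBits_replicate_false]
  simp

/-- The canonical third coordinate: alternating blocks (block lengths). -/
theorem pull_unrank3_c (hc : c < 2 ^ m) : pull m (unrank3 m a b c) c =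
    (2 ^ ((lab m a b).filter (fun x => tb c x)).length - 1) + 2 ^ ((lab m a b).filter (fun x => tb c x)).length *
      (2 ^ ((lab m a b).filter (fun x => !(tb c x))).length * ((2 ^ ((lanb m a b).filter (fun x => tb c x)).length - 1) +
        2 ^ ((lanb m a b).filter (fun x => tb c x)).length * (2 ^ ((lanb m a b).filter (fun x => !(tb c x))).length *
          ((2 ^ ((lnab m a b).filter (fun x => tb c x)).length - 1) + 2 ^ ((lnab m a b).filter (fun x => tb c x)).length *
            (2 ^ ((lnab m a b).filter (fun x => !(tb c x))).length * (2 ^ ((lnanb m a b).filter (fun x => tb c x)).length - 1)))))) := by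
  rw [show unrank3 m a b c = fun p => (classList3 m a b c).getD p p from rfl,
    pull_getD_eq_ofBits m _ (classList3_length m a b c) hc, classList3_map_c, ofBits_true_append, ofBits_false_append,
    ofBits_true_append, ofBits_false_append, ofBits_true_append, ofBits_false_append, ofBits_true_append, ofBits_replicate_false]
  simp

end Blocks


/-! ### Block lengths as popcounts -/

section Counts

variable (m a b c : ℕ)

/-- Number of relays passing a test. -/
def cnt (P : ℕ → Bool) : ℕ := ((List.range m).filter P).length

/-- Nested filters are one filter by the conjunction (in this order). -/
theorem filter_filter' (l : List ℕ) (p q : ℕ → Bool) : (l.filter p).filter q = l.filter fun x => p x && q x := by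
  induction l with
  | nil => rfl
  | cons x t ih =>
    simp only [List.filter_cons]
    cases hp : p x <;> cases hq : q x <;> simp [hq, ih]

/-- A count splits along a further test. -/
theorem cnt_split (P q : ℕ → Bool) : cnt m P = cnt m (fun x => P x && q x) + cnt m (fun x => P x && !(q x)) := by
  unfold cnt; rw [← filter_filter', ← filter_filter']; exact List.length_eq_length_filter_add _

/-- Counts of pointwise equal tests agree. -/
theorem cnt_congr {P Q : ℕ → Bool} (h : ∀ x, P x = Q x) : cnt m P = cnt m Q := by
  unfold cnt; rw [List.filter_congr fun x _ => h x]

/-- `tb` of a conjunction. -/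
theorem tb_and (a b x : ℕ) : tb (a &&& b) x = (tb a x && tb b x) := by
  rw [tb_eq, tb_eq, tb_eq, Nat.testBit_and]

/-- `popc` as a count. -/
theorem popc_eq_cnt (K : ℕ) : popc m K = cnt m fun x => tb K x := rfl

/-- `|a| = popc m a`. -/
theorem la_length : (la m a).length = popc m a := rfl
/-- `a ∩ b` as one filter. -/
theorem lab_eq : lab m a b = (List.range m).filter fun x => tb a x && tb b x := by unfold lab la rl; rw [filter_filter']
/-- `a ∖ b` as one filter. -/
theorem lanb_eq : lanb m a b = (List.range m).filter fun x => tb a x && !(tb b x) := by unfold lanb la rl; rw [filter_filter']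
/-- `b ∖ a` as one filter. -/
theorem lnab_eq : lnab m a b = (List.range m).filter fun x => !(tb a x) && tb b x := by unfold lnab lna rl; rw [filter_filter']
/-- The complement of `a ∪ b` as one filter. -/
theorem lnanb_eq : lnanb m a b = (List.range m).filter fun x => !(tb a x) && !(tb b x) := by unfold lnanb lna rl; rw [filter_filter']
/-- `|a ∩ b|` as a count. -/
theorem lab_length : (lab m a b).length = cnt m fun x => tb a x && tb b x := by rw [lab_eq]; rfl
/-- `|a ∖ b|` as a count. -/
theorem lanb_length : (lanb m a b).length = cnt m fun x => tb a x && !(tb b x) := by rw [lanb_eq]; rfl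
/-- `|b ∖ a|` as a count. -/
theorem lnab_length : (lnab m a b).length = cnt m fun x => !(tb a x) && tb b x := by rw [lnab_eq]; rfl
/-- Block 1 (`a ∩ b ∩ c`) as a count. -/
theorem b1_length : ((lab m a b).filter fun x => tb c x).length = cnt m fun x => (tb a x && tb b x) && tb c x := by
  rw [lab_eq, filter_filter']; rfl
/-- Block 2 (`a ∩ b ∖ c`) as a count. -/
theorem b2_length : ((lab m a b).filter fun x => !(tb c x)).length = cnt m fun x => (tb a x && tb b x) && !(tb c x) := by
  rw [lab_eq, filter_filter']; rfl
/-- Block 3 (`a ∖ b ∩ c`) as a count. -/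
theorem b3_length : ((lanb m a b).filter fun x => tb c x).length = cnt m fun x => (tb a x && !(tb b x)) && tb c x := by
  rw [lanb_eq, filter_filter']; rfl
/-- Block 4 (`a ∖ b ∖ c`) as a count. -/
theorem b4_length : ((lanb m a b).filter fun x => !(tb c x)).length = cnt m fun x => (tb a x && !(tb b x)) && !(tb c x) := by
  rw [lanb_eq, filter_filter']; rfl
/-- Block 5 (`b ∖ a ∩ c`) as a count. -/
theorem b5_length : ((lnab m a b).filter fun x => tb c x).length = cnt m fun x => (!(tb a x) && tb b x) && tb c x := by
  rw [lnab_eq, filter_filter']; rfl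
/-- Block 6 (`b ∖ a ∖ c`) as a count. -/
theorem b6_length : ((lnab m a b).filter fun x => !(tb c x)).length = cnt m fun x => (!(tb a x) && tb b x) && !(tb c x) := by
  rw [lnab_eq, filter_filter']; rfl
/-- Block 7 (`c ∖ (a ∪ b)`) as a count. -/
theorem b7_length : ((lnanb m a b).filter fun x => tb c x).length = cnt m fun x => (!(tb a x) && !(tb b x)) && tb c x := by
  rw [lnanb_eq, filter_filter']; rfl

/-- **The block lengths of `classList3` in terms of the seven popcounts.** -/
theorem block_lengths :
    (la m a).length = popc m a ∧
    (lab m a b).length = popc m (a &&& b) ∧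
    (lanb m a b).length = popc m a - popc m (a &&& b) ∧
    (lnab m a b).length = popc m b - popc m (a &&& b) ∧
    ((lab m a b).filter fun x => tb c x).length = popc m (a &&& b &&& c) ∧
    ((lab m a b).filter fun x => !(tb c x)).length = popc m (a &&& b) - popc m (a &&& b &&& c) ∧
    ((lanb m a b).filter fun x => tb c x).length = popc m (a &&& c) - popc m (a &&& b &&& c) ∧
    ((lanb m a b).filter fun x => !(tb c x)).length = (popc m a - popc m (a &&& b)) - (popc m (a &&& c) - popc m (a &&& b &&& c)) ∧
    ((lnab m a b).filter fun x => tb c x).length = popc m (b &&& c) - popc m (a &&& b &&& c) ∧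
    ((lnab m a b).filter fun x => !(tb c x)).length = (popc m b - popc m (a &&& b)) - (popc m (b &&& c) - popc m (a &&& b &&& c)) ∧
    ((lnanb m a b).filter fun x => tb c x).length = (popc m c - popc m (a &&& c)) - (popc m (b &&& c) - popc m (a &&& b &&& c)) := by
  -- everything as counts of Boolean combinations of the three tests
  have pab : popc m (a &&& b) = cnt m fun x => tb a x && tb b x := cnt_congr m fun x => tb_and a b x
  have pac : popc m (a &&& c) = cnt m fun x => tb a x && tb c x := cnt_congr m fun x => tb_and a c x
  have pbc : popc m (b &&& c) = cnt m fun x => tb b x && tb c x := cnt_congr m fun x => tb_and b c x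
  have pabc : popc m (a &&& b &&& c) = cnt m fun x => (tb a x && tb b x) && tb c x :=
    cnt_congr m fun x => by rw [tb_and, tb_and]
  -- splits
  have sa := cnt_split m (fun x => tb a x) (fun x => tb b x)
  have sab := cnt_split m (fun x => tb a x && tb b x) (fun x => tb c x)
  have saB := cnt_split m (fun x => tb a x && !(tb b x)) (fun x => tb c x)
  have sAb := cnt_split m (fun x => !(tb a x) && tb b x) (fun x => tb c x)
  have sb := cnt_split m (fun x => tb b x) (fun x => tb a x)
  have sc := cnt_split m (fun x => tb c x) (fun x => tb a x)
  have scA := cnt_split m (fun x => tb c x && !(tb a x)) (fun x => tb b x)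
  have sac := cnt_split m (fun x => tb a x && tb c x) (fun x => tb b x)
  have sbc := cnt_split m (fun x => tb b x && tb c x) (fun x => tb a x)
  -- identifications of equal Boolean combinations
  have e1 : cnt m (fun x => tb b x && tb a x) = cnt m (fun x => tb a x && tb b x) :=
    cnt_congr m fun x => by cases tb a x <;> cases tb b x <;> rfl
  have e2 : cnt m (fun x => tb b x && !(tb a x)) = cnt m (fun x => !(tb a x) && tb b x) :=
    cnt_congr m fun x => by cases tb a x <;> cases tb b x <;> rfl
  have e3 : cnt m (fun x => (tb a x && tb c x) && tb b x) = cnt m (fun x => (tb a x && tb b x) && tb c x) :=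
    cnt_congr m fun x => by cases tb a x <;> cases tb b x <;> cases tb c x <;> rfl
  have e4 : cnt m (fun x => (tb a x && tb c x) && !(tb b x)) = cnt m (fun x => (tb a x && !(tb b x)) && tb c x) :=
    cnt_congr m fun x => by cases tb a x <;> cases tb b x <;> cases tb c x <;> rfl
  have e5 : cnt m (fun x => (tb b x && tb c x) && tb a x) = cnt m (fun x => (tb a x && tb b x) && tb c x) :=
    cnt_congr m fun x => by cases tb a x <;> cases tb b x <;> cases tb c x <;> rfl
  have e6 : cnt m (fun x => (tb b x && tb c x) && !(tb a x)) = cnt m (fun x => (!(tb a x) && tb b x) && tb c x) :=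
    cnt_congr m fun x => by cases tb a x <;> cases tb b x <;> cases tb c x <;> rfl
  have e7 : cnt m (fun x => tb c x && tb a x) = cnt m (fun x => tb a x && tb c x) :=
    cnt_congr m fun x => by cases tb a x <;> cases tb c x <;> rfl
  have e8 : cnt m (fun x => (tb c x && !(tb a x)) && tb b x) = cnt m (fun x => (!(tb a x) && tb b x) && tb c x) :=
    cnt_congr m fun x => by cases tb a x <;> cases tb b x <;> cases tb c x <;> rfl
  have e9 : cnt m (fun x => (tb c x && !(tb a x)) && !(tb b x)) = cnt m (fun x => (!(tb a x) && !(tb b x)) && tb c x) :=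
    cnt_congr m fun x => by cases tb a x <;> cases tb b x <;> cases tb c x <;> rfl
  rw [la_length, lab_length, lanb_length, lnab_length, b1_length, b2_length, b3_length, b4_length, b5_length, b6_length, b7_length,
    popc_eq_cnt m a, popc_eq_cnt m b, popc_eq_cnt m c, pab, pac, pbc, pabc]
  omega

end Counts

end QCert
end HubOnly

end Summit.CriticalPhenomena.PercolationContinuityZ3.Theorems
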